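/-
Copyright (c) 2026. All rights reserved.
Released under Apache 2.0 license as described in the file LICENSE.
Authors: abc-iut cell, seat abc-iut-w5-d053 (gen 4; row «COR37-LOGOBS-GLUE», part (b) of abc-iut-L4-t5's
«COR37-COMPAT-LITERAL» split — presentations of glued pairs).
-/
import Literature.AnabelianGeometry.AbsoluteAnabelian.AbsTopIII.BiAnabelianLogGlue
import HarnessLib

/-!
# [AbsTopIII] Cor 3.7 (iii), second clause — PRESENTATIONS of glued pairs on `Γ⃗_{𝒟*}` (combinatorics)

S. Mochizuki, *Topics in absolute anabelian geometry III* [MochizukiAbsTopIII2015] (kurims manuscript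
`paper:url-5493eb38cbb7`), Cor 3.7 (iii) p. 88, Cor 3.7 (ii) p. 87 (the oriented graph `Γ⃗_{𝒟*}`), proof of
Cor 3.6 (iii) p. 81 (the cells of `E_log`).

Continuation of `BiAnabelianLogGlue.lean` (boundary set `GlueE`, normal form «𝒳-pair THEN cell»).  PURE
COMBINATORICS on `Γ⃗_{𝒟*}`, no setting: a cell is determined by its two sides (`StarCell.ext'`, abc-iut-L4-t9
lineage's `ObsCell.ext'`); a cell whose sides visit `ref` is a ref-free cell behind a prefix
(`StarCell.exists_precomp_of_visitsRef`); paths out of `𝒩`, `𝔈`; and `GlueDec` — the constructors of `GlueE`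
off `𝔈` as a TYPE with the two paths as free indices (the identifications are fields), so that the homotopy of
a glued pair can be defined by cases and presentations taken apart without index unification
(`BiAnabelianLogGlueEta.lean`).

HONEST FRAMING: bookkeeping; no `Prop` fact, no instance; nothing here bears on [IUTchIII] Cor. 3.12.
-/

set_option autoImplicit false

namespace Literature.AnabelianGeometry.AbsoluteAnabelian.AbsTopIII

open Quiver

universe w

/-! ## More combinatorics of cells on `Γ⃗_{𝒟*}` -/

namespace StarGlue

namespace StarCell

variable {x : Cor37Vertex}

/-- A cell is determined by its two sides (the type is read off the last edges, the prefix off the paths;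
abc-iut-L4-t9 lineage's `ObsCell.ext'` on `𝒟*`). [cite: MochizukiAbsTopIII2015, Cor 3.7 (iii) p.88] -/
theorem ext' {g g' : StarCell.{w} x} (hl : g.left = g'.left) (hr : g.right = g'.right) : g = g' := by
  cases g with
  | refl r e =>
    cases g' with
    | refl r' e' =>
      obtain rfl := eq_of_heq (Path.heq_of_cons_eq_cons hl)
      obtain rfl := eq_of_heq (Path.hom_heq_of_cons_eq_cons hl)
      rfl
    | times r' =>
      have h₁ := eq_of_heq (Path.hom_heq_of_cons_eq_cons hl)
      have h₂ := eq_of_heq (Path.hom_heq_of_cons_eq_cons hr)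
      exact absurd (h₁.symm.trans h₂) (fun h => by cases h)
    | log n' r' =>
      have h₁ := eq_of_heq (Path.hom_heq_of_cons_eq_cons hl)
      have h₂ := eq_of_heq (Path.hom_heq_of_cons_eq_cons hr)
      exact absurd (h₁.symm.trans h₂) (fun h => by cases h)
  | times r =>
    cases g' with
    | refl r' e' =>
      have h₁ := eq_of_heq (Path.hom_heq_of_cons_eq_cons hl)
      have h₂ := eq_of_heq (Path.hom_heq_of_cons_eq_cons hr)
      exact absurd (h₁.trans h₂.symm) (fun h => by cases h)
    | times r' =>
      obtain rfl := eq_of_heq (Path.heq_of_cons_eq_cons hl)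
      rfl
    | log n' r' =>
      have h₁ := eq_of_heq (Path.heq_of_cons_eq_cons hl)
      have h₂ := eq_of_heq (Path.heq_of_cons_eq_cons hr)
      have h := Path.obj_eq_of_cons_eq_cons (h₁.symm.trans h₂)
      simp only [Cor37Vertex.first.injEq] at h
      omega
  | log n r =>
    cases g' with
    | refl r' e' =>
      have h₁ := eq_of_heq (Path.hom_heq_of_cons_eq_cons hl)
      have h₂ := eq_of_heq (Path.hom_heq_of_cons_eq_cons hr)
      exact absurd (h₁.trans h₂.symm) (fun h => by cases h)
    | times r' =>
      have h₁ := eq_of_heq (Path.heq_of_cons_eq_cons hl)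
      have h₂ := eq_of_heq (Path.heq_of_cons_eq_cons hr)
      have h := Path.obj_eq_of_cons_eq_cons (h₁.trans h₂.symm)
      simp only [Cor37Vertex.first.injEq] at h
      omega
    | log n' r' =>
      have h₂ := eq_of_heq (Path.heq_of_cons_eq_cons hr)
      have h := Path.obj_eq_of_cons_eq_cons h₂
      simp only [Cor37Vertex.first.injEq] at h
      obtain rfl : n = n' := by omega
      obtain rfl := eq_of_heq (Path.heq_of_cons_eq_cons h₂)
      rfl

/-- The prefix-to-`□`-or-`⋎+1` part of a cell visits `ref` iff its sides do: a cell whose sides visit `ref`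
is a cell from `ref` with ref-free sides behind a prefix ending at `ref` (split at the last visit).
[cite: MochizukiAbsTopIII2015, Cor 3.7 (iii) p.88] -/
theorem exists_precomp_of_visitsRef (g : StarCell.{w} x) (h : VisitsRef g.left) :
    ∃ (s : StarPath.{w} x Cor37Vertex.ref) (g₀ : StarCell.{w} Cor37Vertex.ref),
      g = g₀.precomp s ∧ refCount g₀.left = 0 := by
  cases g with
  | refl r e =>
    have hr : VisitsRef r := by
      rcases h with h | h
      · exact Or.inl h
      · exact Or.inr (by simpa [left] using h)
    obtain ⟨S⟩ := nonempty_refSplit r hr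
    exact ⟨S.head, refl S.tail e, by rw [precomp, ← S.eq], by simp [left, S.free]⟩
  | times r =>
    have hr : VisitsRef r := by
      rcases h with h | h
      · exact Or.inl h
      · exact Or.inr (by simpa [left] using h)
    obtain ⟨S⟩ := nonempty_refSplit r hr
    exact ⟨S.head, times S.tail, by rw [precomp, ← S.eq], by simp [left, S.free]⟩
  | log n r =>
    have hr : VisitsRef r := by
      rcases h with h | h
      · exact Or.inl h
      · exact Or.inr (by simpa [left] using h)
    obtain ⟨S⟩ := nonempty_refSplit r hr
    exact ⟨S.head, log n S.tail, by rw [precomp, ← S.eq], by simp [left, S.free]⟩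

end StarCell

/-- A path out of `𝒩` is trivial or the single edge `𝒩 → 𝔈`. [cite: MochizukiAbsTopIII2015, Cor 3.7 (ii) p.87] -/
theorem path_space_galois_eq (r : StarPath.{w} Cor37Vertex.space Cor37Vertex.galois) :
    r = (Path.nil : StarPath.{w} Cor37Vertex.space Cor37Vertex.space).cons Cor37Edge.toGal := by
  cases r with
  | cons t e =>
    cases t with
    | nil => cases e; rfl
    | cons t' e' =>
      have hc := eq_galois_of_path_cons (d := Cor37Vertex.space) (by simp [Cor37Vertex.row]) t' e'
      subst hc
      cases e

/-- A path `𝒩 → 𝒩` is trivial. [cite: MochizukiAbsTopIII2015, Cor 3.7 (ii) p.87] -/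
theorem path_space_space_eq (r : StarPath.{w} Cor37Vertex.space Cor37Vertex.space) : r = Path.nil := by
  cases r with
  | nil => rfl
  | cons t e =>
    have hc := eq_galois_of_path_cons (d := Cor37Vertex.space) (by simp [Cor37Vertex.row]) t e
    cases hc

/-- A path `𝔈 → 𝔈` is trivial. [cite: MochizukiAbsTopIII2015, Cor 3.7 (ii) p.87] -/
theorem path_galois_galois_eq (r : StarPath.{w} Cor37Vertex.galois Cor37Vertex.galois) : r = Path.nil := by
  cases r with
  | nil => rfl
  | cons t e =>
    obtain rfl := eq_galois_of_path_galois t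
    cases e

/-! ## Presentations of glued pairs (the constructors of `GlueE` off `𝔈`, paths as free indices) -/

/-- A PRESENTATION of a glued pair `(P, Q)`: `P = Q`; or `P = p·t`, `Q = q·t` re-routed through `ref` with a
ref-free tail `t`; or the two sides of a cell not visiting `ref`; or `P = p·g.left`, `Q = q·g.right` for a cell
`g` from `ref` with ref-free sides («𝒳-pair THEN cell»).  The paths `P, Q` are free indices and the
identifications are fields, so that presentations can be taken apart without index unification.
[cite: MochizukiAbsTopIII2015, Cor 3.7 (iii) p.88] -/
inductive GlueDec : ∀ ⦃a b : Cor37Vertex⦄, StarPath.{w} a b → StarPath.{w} a b → Type w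
  | rfl {a b : Cor37Vertex} {P Q : StarPath.{w} a b} (h : P = Q) : GlueDec P Q
  | reroute {a b : Cor37Vertex} {P Q : StarPath.{w} a b} (p q : StarPath.{w} a Cor37Vertex.ref)
      (t : StarPath.{w} Cor37Vertex.ref b) (ht : refCount t = 0) (hP : P = p.comp t) (hQ : Q = q.comp t) :
      GlueDec P Q
  | cell {a : Cor37Vertex} {P Q : StarPath.{w} a Cor37Vertex.space} (g : StarCell.{w} a)
      (hg : ¬ VisitsRef g.left) (hP : P = g.left) (hQ : Q = g.right) : GlueDec P Q
  | tailCell {a : Cor37Vertex} {P Q : StarPath.{w} a Cor37Vertex.space}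
      (p q : StarPath.{w} a Cor37Vertex.ref) (g : StarCell.{w} Cor37Vertex.ref) (hg : refCount g.left = 0)
      (hP : P = p.comp g.left) (hQ : Q = q.comp g.right) : GlueDec P Q

/-- A presented pair is glued. [cite: MochizukiAbsTopIII2015, Cor 3.7 (iii) p.88] -/
theorem GlueDec.glueE {a b : Cor37Vertex} {P Q : StarPath.{w} a b} : GlueDec P Q → GlueE P Q
  | rfl h => h ▸ GlueE.rfl P
  | reroute p q t ht hP hQ => hP ▸ hQ ▸ GlueE.tailEq p q t ht
  | cell g hg hP hQ => hP ▸ hQ ▸ GlueE.cell g hg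
  | tailCell p q g hg hP hQ => hP ▸ hQ ▸ GlueE.tailCell p q g hg

/-- A glued pair not ending at `𝔈` is presented. [cite: MochizukiAbsTopIII2015, Cor 3.7 (iii) p.88] -/
theorem nonempty_glueDec {a b : Cor37Vertex} {P Q : StarPath.{w} a b} (h : GlueE P Q)
    (hb : b ≠ Cor37Vertex.galois) : Nonempty (GlueDec P Q) := by
  cases h with
  | rfl P => exact ⟨GlueDec.rfl rfl⟩
  | gal P R => exact absurd rfl hb
  | cell g hg => exact ⟨GlueDec.cell g hg rfl rfl⟩
  | tailEq p q t ht => exact ⟨GlueDec.reroute p q t ht rfl rfl⟩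
  | tailCell p q g hg => exact ⟨GlueDec.tailCell p q g hg rfl rfl⟩

/-- Every pair re-routed through `ref` (arbitrary tail) has a re-routing presentation (split the tail at its
last visit to `ref`). [cite: MochizukiAbsTopIII2015, Cor 3.7 (iii) p.88] -/
theorem exists_glueDec_reroute {a b : Cor37Vertex} (p q : StarPath.{w} a Cor37Vertex.ref)
    (s : StarPath.{w} Cor37Vertex.ref b) :
    ∃ (p' q' : StarPath.{w} a Cor37Vertex.ref) (t : StarPath.{w} Cor37Vertex.ref b),
      refCount t = 0 ∧ p.comp s = p'.comp t ∧ q.comp s = q'.comp t := by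
  obtain ⟨S⟩ := nonempty_refSplit s (Or.inl rfl)
  exact ⟨p.comp S.head, q.comp S.head, S.tail, S.free, by rw [Path.comp_assoc, ← S.eq],
    by rw [Path.comp_assoc, ← S.eq]⟩

end StarGlue

end Literature.AnabelianGeometry.AbsoluteAnabelian.AbsTopIII
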